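import Mathlib.Order.Filter.AtTopBot.Basic
import Mathlib.Analysis.SpecialFunctions.Pow.Real
import Mathlib.Data.Nat.Log
import Literature.Computability.Cryptography.FGCoreProblems
import Literature.Computability.Complexity.Circuit
import HarnessLib

-- provenance: harness21/H21/H21/Statements/FineGrained/MonotoneOV.lean @ 7f20f4c (interim HEAD d8f2665); M5 mechanical rewrite
/-!
# Fine-grained complexity: monotone circuit lower bounds for `¬OV`

Family `fine-grained` (trunk CryptoQuantFine, outline §3 `FineGrained/MonotoneOV`).

Statement **fine-grained.S25** (Choudhury–Limaye–Sreenivasaiah et al., ECCC TR26-121 /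
arXiv:2607.23799 (2026)): monotone circuits for `¬OV_{n, c log n}` need size `Ω(n^{2-ε})`, and
monotone formulas for `¬OV_{n,d}` need size `Ω(n² d)` (in the regime `d ≥ c₀ log n`; see the
design notes for why the range of `d` must be restricted).

## Sources used

* `Literature.CryptoQuantFine.notOVFn n d : (Fin 2 × Fin n × Fin d → Bool) → Bool` (prelude F3, `FGCoreProblems`), the
  negated orthogonal-vectors Boolean function, with `notOVFn_monotone` and `notOVFn_nonconst`.
* `Literature.Computability.Complexity.circuitSizeOver`, `Literature.Computability.Complexity.formulaSizeOver`, `Literature.Computability.Complexity.monotoneBasis`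
  (prelude G01, `CplxCore/Circuit`). Mathlib has no Boolean circuit library (grep for
  `Circuit`/`circuitSize` finds only matroid circuits), so these H21 notions are used.

## Design notes

* `circuitSizeOver B f` / `formulaSizeOver B f` are `sInf`s over `ℕ` and take the junk value `0`
  when no circuit over `B` computes `f`. Since `notOVFn n d` is monotone and non-constant for
  `n, d ≥ 1` (`notOVFn_monotone`, `notOVFn_nonconst`), it is computed by a monotone
  `{∧₂, ∨₂}`-circuit (indeed a formula: its monotone DNF), so over `monotoneBasis` the infimum is
  attained and the lower bounds below are not about the junk value. In the circuit statement the
  dimension `c * Nat.log 2 n` is `≥ 1` eventually (as `c ≥ 1`), and in the formula statement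
  `d ≥ c₀ * Nat.log 2 n ≥ 1` eventually (as `c₀ ≥ 1`), so `n, d ≥ 1` in both bounds.
* The circuit bound is phrased with real exponents `(n : ℝ) ^ (2 - ε)` and `∀ᶠ n in atTop`; the
  `Ω`-constant is absorbed by shrinking `ε`.
* Range of `d` in the formula bound (conservative reading, outline R8-style note). The inventory
  text "formulas need `Ω(n² d)`" does not pin the range of `d`, and the outline's literal range
  "all `n, d ≥ 1`" is provably wrong: for `d = 1`,
  `notOVFn n 1 x = (∀ i, x (0,i,0)) ∧ (∀ j, x (1,j,0))` is an `{∧₂}`-formula with `2n - 1` gates, and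
  more generally for every fixed `d` the function `¬OV_{n,d}` has monotone formulas of size `O_d(n)`.
  An `Ω(n² d)` bound can therefore only hold once `d` grows with `n`; we state it in the same regime
  as the circuit bound, `d ≥ c₀ log n` for some constant `c₀ ≥ 1`, eventually in `n`, with an
  explicit real constant `c > 0`. (This outline bug is flagged to the architect.)
* fine-grained.S26 (Williams 2024, OV-type hypotheses imply non-uniform circuit lower bounds) is
  deliberately not stated here (outline R9).
-/

namespace Literature.Computability.FineGrained

open Filter Complexity Cryptography

/-- **fine-grained.S25** (monotone circuit lower bound for `¬OV`; Choudhury–Limaye–Sreenivasaiah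
et al., ECCC TR26-121 / arXiv:2607.23799 (2026)). For every `ε > 0` there is a constant `c ≥ 1`
such that every monotone circuit (over the basis `{∧₂, ∨₂}`) computing `¬OV_{n, c log n}` has size
at least `n^{2-ε}` for all sufficiently large `n`. Here `notOVFn n d` is monotone and non-constant
for `n, d ≥ 1` (`notOVFn_monotone`, `notOVFn_nonconst`), so `circuitSizeOver monotoneBasis` is a
genuine minimum and not the junk value `0`. [cite: arXiv260723799] -/
def monotone_circuit_notOV_lower_bound : Prop :=
  ∀ (ε : ℝ) (hε : 0 < ε),
    ∃ c : ℕ, 1 ≤ c ∧ ∀ᶠ n : ℕ in atTop,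
      (n : ℝ) ^ (2 - ε) ≤ circuitSizeOver monotoneBasis (notOVFn n (c * Nat.log 2 n))

/-- **fine-grained.S25** (monotone formula lower bound for `¬OV`; Choudhury–Limaye–Sreenivasaiah
et al., ECCC TR26-121 / arXiv:2607.23799 (2026)). There are absolute constants `c > 0` and
`c₀ ≥ 1` such that, for all sufficiently large `n` and every dimension `d ≥ c₀ log n`, every
monotone formula (over the basis `{∧₂, ∨₂}`) computing `¬OV_{n,d}` has size at least `c · n² · d`.
As above, for such `n, d` (both `≥ 1`) `notOVFn n d` is monotone and non-constant, so it has a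
monotone formula (its monotone DNF) and `formulaSizeOver monotoneBasis` is not the junk value `0`.
The inventory text does not pin the range of `d`; the range `d = O(1)` is provably excluded
(`¬OV_{n,1}` has an `{∧₂}`-formula with `2n - 1` gates), so the regime `d ≥ c₀ log n` chosen here
is a conservative reading (see the module docstring). If the paper's `Ω(n² d)` bound is for
de Morgan formulas, the statement here is the (weaker) consequence, since
`monotoneBasis ⊆ deMorganBasis` (`monotoneBasis_subset_deMorgan`) can only decrease the minimal
formula size (the `formulaSizeOver` analogue of `circuitSizeOver_mono`, not yet in G01). [cite: arXiv260723799] -/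
def monotone_formula_notOV_lower_bound : Prop :=
  ∃ c : ℝ, 0 < c ∧ ∃ c₀ : ℕ, 1 ≤ c₀ ∧ ∀ᶠ n : ℕ in atTop, ∀ d : ℕ, c₀ * Nat.log 2 n ≤ d →
      c * (n : ℝ) ^ 2 * d ≤ formulaSizeOver monotoneBasis (notOVFn n d)

end Literature.Computability.FineGrained
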